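import Mathlib.Algebra.BigOperators.NatAntidiagonal
import Mathlib.Algebra.BigOperators.Group.Finset.Basic
import Mathlib.Data.Real.Basic
import Mathlib.Tactic.Ring
import Mathlib.Tactic.LinearCombination

/-!
# `BalabanUV.Beta.GAN24.CrossedLedgerTelescope` — binder row G-an2-4 ∕ (CONV-C), W-slot (α-0), ROW (C)sym AT LEVELS `≥ 1`, typer's PART VI row **T6-VAL** (the crossed
# ledger `hX` ∕ `hXu` of the OWNER's two-index tower): **IF THE FORCING's FACE CROSSED VALUES HAVE THE DEPTH-TOWER SHAPE, THE TWO ANTI-DIAGONAL FACE SUMS OF leaf-03 g71's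
# UNROLLED LEDGER TELESCOPE, AND — WITH ONE PREFACTOR IDENTITY — EVERY DEEP VALUE DROPS OUT OF (VAL-l)**: what is left per level is a LEVEL-0 ∕ LEVEL-1 identity
# (G-an2-4 CRUX TEAM (2), leaf prover `b2b-balaban-gan24-formalise-leaf-06`, the (γ) hand, gen 55; journal [GAN24LEAF06-G55-INTENT3]; memo `HOME/…/leaf-06/g55/HX-VALUES-g55.md` §3)

NOT IN PRINT; OUR BOOKKEEPING ([folklore] finite telescoping over `Finset.antidiagonal` ∕ `Finset.range`, `ring`; `import Mathlib` pieces only — lane-independent; 0 `def`, 0 cited fact,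
0 `def … : Prop`, 0 sorry).  HONEST FRAMING (cell contract, verbatim): «discharging `BetaPertH` makes Bałaban's UV stability UNCONDITIONAL — a real constructive-QFT result; it is NOT the
continuum limit and NOT the Clay problem.»  HONEST DEPENDENCY (verbatim): «continuum YM on T⁴ ⇐ BetaPertH ∧ nine spine estimates (0/9 proved); BetaPertH ⇐ (D1) ∧ (D4) ∧ CAP+tail;
G-an2-4 gates asym, D1 and NE2/3/4.»

WHY.  leaf-03 g71's `CrossedLedgerForcing.memberCrossedRatio_iff_forcingLedger_pin_closed` turns road-P2's `hXu` into, per level `l` and crossed pattern `(a,b)`,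
  `[X(zmode_Lc b̃_{l+1}) − X(zmode_Lc b̃_l)] + γ·([Σ_{k<l+1} X(FFsym_{P(l−k)} b̃_k) − Σ_{k<l} X(FFsym_{P(l−1−k)} b̃_k)] + ΔB(l)) = 0`,   (VAL-l)
cell crossed values `Xc i`, face crossed values `Xf k m` (forcing level `k`, period index `m`), base bracket `ΔB`.  The (γ) hand's depth tower predicts their SHAPES (memo §3; this
file takes them as HYPOTHESES, asserting nothing): for levels `≥ 1`, `Xc (i+1) = κ_{i+1}·V(i+1, 1)` (this lineage's `ForcingCellPairFormSucc.crossed_zmode_forcing_succ`: one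
Green's-function pairing `V(i, n) = ⟨q^{(Lc^n)}, E2_i q^{(Lc^n)}⟩`) and `Xf (k+1) m = c_{k+1}·(V(k+1, m+2) − ρ·V(k+2, m+1))` (the L4 sandwich ∕ K5 bridge ∕ K3: «the same pairing
one level up, one period down»), with geometric prefactors `c_{k+2} = ρ·c_{k+1}`.  THEN (this file): (i) each anti-diagonal face sum over the forcing levels `≥ 1` TELESCOPES to
`c_1·V(1, ·) − c_{top}·V(top, 1)`; (ii) if moreover `κ_i = γ·c_i` for `i ≥ 1` (ONE prefactor identity — letter K7-b), the deep values `V(l+2, 1)`, `V(l+1, 1)` CANCEL between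
the cell bracket and the face brackets, and (VAL-(l+1))'s left side collapses to `γ·((Xf 0 (l+1) − Xf 0 l) + c_1·(V(1, l+2) − V(1, l+1))) + ΔB(l+1)` — ONLY the level-0 forcing's
face words, the LEVEL-1 pairings at deep periods, and the base.  So, granted the shapes, `hXu` is a level-0 ∕ level-1 identity family in the period index — where leaf-04's
structural level-0 ∕ 1 technology (CSYM-D3-ANATOMY §3 ∕ §6) lives.

WHAT ([folklore]; all letters are free functions ∕ scalars: `V : ℕ → ℕ → ℝ`, `c κ : ℕ → ℝ`, `Xc : ℕ → ℝ`, `Xf : ℕ → ℕ → ℝ`, `ρ γ : ℝ`):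
* §1 **`antidiag_telescope`** (`hface`, `hc`): `Σ_{p ∈ antidiagonal n} Xf (p.1+1+s) p.2 = c (s+1)·V (s+1) (n+2) − c (n+s+2)·V (n+s+2) 1` (every shift `s`; induction on `n`);
* §2 **`faceSum_antidiag_eq`**: `Σ_{k ∈ range (l+1)} Xf k (l−k) = Xf 0 l + (c 1·V 1 (l+1) − c (l+1)·V (l+1) 1)` (leaf-03's range-with-subtraction spelling of the anti-diagonal);
* §3 **`valLedger_lhs_eq`** (`hcell`, `hface`, `hc`, `hκ`): `(Xc (l+2) − Xc (l+1)) + γ·(Σ_{k<l+2} Xf k (l+1−k) − Σ_{k<l+1} Xf k (l−k)) = γ·((Xf 0 (l+1) − Xf 0 l) + c 1·(V 1 (l+2) − V 1 (l+1)))`;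
  **`valLedger_iff_lowLevel`**: hence (VAL-(l+1)) `⟺ γ·((Xf 0 (l+1) − Xf 0 l) + c 1·(V 1 (l+2) − V 1 (l+1))) + ΔB = 0`.
* §4 **`valLedger_iff_levelZero`** (+ the bridge shape at level `0`, `Xf 0 m = c 0·(R m − ρ·V 1 (m+1))`, and `c 1 = ρ·c 0`): (VAL-(l+1)) `⟺ γ·c 0·(R (l+1) − R l) + ΔB = 0` —
  a LEVEL-0 identity between the Wilson-level remainders' first difference and the OWNER's base bracket.
Asserts NO value and NO shape of Bałaban's tables (the shapes are HYPOTHESES; typing them is letters K7-0 ∕ K7-a ∕ K7-b of the memo); discharges NOTHING of `hX` ∕ `hXu` ∕ (C)_{≥1} ∕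
`hB0` ∕ `hBF` ∕ (Q-L) ∕ (hW, hWall); NEVER «G-an2-4 closed» as (CONV-C); NOT D1, NOT `BetaPertH`, NOT continuum, NOT Clay.  2026-08-24; no existing file touched.
-/

open Finset
open scoped BigOperators

namespace Summit.QuantumFields.BalabanUV.Beta.GAN24.CrossedLedgerTelescope

variable {V Xf : ℕ → ℕ → ℝ} {c κ Xc : ℕ → ℝ} {ρ γ : ℝ}

/-! ## §1 One anti-diagonal of depth-tower face values telescopes -/

/-- NOT IN PRINT; OUR BOOKKEEPING.  **THE ANTI-DIAGONAL TELESCOPE** (every shift `s`, every `n`): if the forcing's face crossed values at levels `≥ 1` have the depth-tower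
shape `Xf (k+1) m = c (k+1)·(V (k+1) (m+2) − ρ·V (k+2) (m+1))` and the prefactors are geometric, `c (k+2) = ρ·c (k+1)`, then the face values on the anti-diagonal
`level + period-index = n + 1 + s` sum to the two END pairings: `Σ_{p ∈ antidiagonal n} Xf (p.1+1+s) p.2 = c (s+1)·V (s+1) (n+2) − c (n+s+2)·V (n+s+2) 1`. -/
theorem antidiag_telescope
    (hface : ∀ k m, Xf (k + 1) m = c (k + 1) * (V (k + 1) (m + 2) - ρ * V (k + 2) (m + 1)))
    (hc : ∀ k, c (k + 2) = ρ * c (k + 1)) (n s : ℕ) :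
    ∑ p ∈ antidiagonal n, Xf (p.1 + 1 + s) p.2 = c (s + 1) * V (s + 1) (n + 2) - c (n + s + 2) * V (n + s + 2) 1 := by
  induction n generalizing s with
  | zero =>
    rw [Nat.antidiagonal_zero, sum_singleton]
    dsimp only
    rw [show 0 + 1 + s = s + 1 by ring, hface, show s + 1 + 1 = s + 2 by ring, show 0 + s + 2 = s + 2 by ring,
      show c (s + 2) = ρ * c (s + 1) from hc s]
    ring
  | succ n ih =>
    rw [Nat.sum_antidiagonal_succ]
    dsimp only
    have h1 : ∀ p : ℕ × ℕ, Xf (p.1 + 1 + 1 + s) p.2 = Xf (p.1 + 1 + (s + 1)) p.2 := fun p => by rw [show p.1 + 1 + 1 + s = p.1 + 1 + (s + 1) by ring]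
    simp only [h1, ih (s + 1)]
    rw [show 0 + 1 + s = s + 1 by ring, hface, show s + 1 + 1 = s + 2 by ring, show n + 1 + 2 = n + 3 by ring, show n + 1 + 1 = n + 2 by ring,
      show n + (s + 1) + 2 = n + 1 + s + 2 by ring, show c (s + 2) = ρ * c (s + 1) from hc s]
    ring

/-! ## §2 leaf-03's spelling: the anti-diagonal as a `range` sum with the period index `l − k` -/

/-- NOT IN PRINT; OUR BOOKKEEPING.  **THE FACE SUM OF (VAL-l) IN CLOSED FORM** (hypotheses of §1; every `l`): splitting off the level-`0` forcing (`k = 0`) and telescoping the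
levels `≥ 1`, `Σ_{k ∈ range (l+1)} Xf k (l − k) = Xf 0 l + (c 1·V 1 (l+1) − c (l+1)·V (l+1) 1)` (at `l = 0` the bracket is `0`). -/
theorem faceSum_antidiag_eq
    (hface : ∀ k m, Xf (k + 1) m = c (k + 1) * (V (k + 1) (m + 2) - ρ * V (k + 2) (m + 1)))
    (hc : ∀ k, c (k + 2) = ρ * c (k + 1)) (l : ℕ) :
    ∑ k ∈ range (l + 1), Xf k (l - k) = Xf 0 l + (c 1 * V 1 (l + 1) - c (l + 1) * V (l + 1) 1) := by
  rw [← Nat.sum_antidiagonal_eq_sum_range_succ (fun k m => Xf k m) l]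
  cases l with
  | zero =>
    rw [Nat.antidiagonal_zero, sum_singleton]
    dsimp only
    ring
  | succ n =>
    rw [Nat.sum_antidiagonal_succ]
    dsimp only
    have h0 : ∀ p : ℕ × ℕ, Xf (p.1 + 1) p.2 = Xf (p.1 + 1 + 0) p.2 := fun p => by rw [Nat.add_zero]
    simp only [h0, antidiag_telescope hface hc n 0]

/-! ## §3 (VAL-l)'s left side with the depth-tower shapes: the deep values drop out -/

/-- NOT IN PRINT; OUR BOOKKEEPING.  **THE DEEP VALUES CANCEL** (hypotheses of §1, the cell shape `Xc (i+1) = κ (i+1)·V (i+1) 1` at levels `≥ 1`, and ONE prefactor identity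
`κ (i+1) = γ·c (i+1)`): for every `l`,
`(Xc (l+2) − Xc (l+1)) + γ·(Σ_{k<l+2} Xf k (l+1−k) − Σ_{k<l+1} Xf k (l−k)) = γ·((Xf 0 (l+1) − Xf 0 l) + c 1·(V 1 (l+2) − V 1 (l+1)))` — the left side of leaf-03's (VAL-(l+1))
without its base bracket involves, after the telescope, ONLY the level-`0` forcing's face values and the LEVEL-`1` pairings at the two deepest periods. -/
theorem valLedger_lhs_eq
    (hcell : ∀ i, Xc (i + 1) = κ (i + 1) * V (i + 1) 1)
    (hface : ∀ k m, Xf (k + 1) m = c (k + 1) * (V (k + 1) (m + 2) - ρ * V (k + 2) (m + 1)))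
    (hc : ∀ k, c (k + 2) = ρ * c (k + 1)) (hκ : ∀ i, κ (i + 1) = γ * c (i + 1)) (l : ℕ) :
    (Xc (l + 2) - Xc (l + 1)) + γ * (∑ k ∈ range (l + 2), Xf k (l + 1 - k) - ∑ k ∈ range (l + 1), Xf k (l - k))
      = γ * ((Xf 0 (l + 1) - Xf 0 l) + c 1 * (V 1 (l + 2) - V 1 (l + 1))) := by
  rw [faceSum_antidiag_eq hface hc (l + 1), faceSum_antidiag_eq hface hc l,
    show l + 2 = l + 1 + 1 by ring, hcell (l + 1), hcell l, hκ (l + 1), hκ l]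
  ring

/-- NOT IN PRINT; OUR BOOKKEEPING.  **HENCE (VAL-(l+1)) IS A LEVEL-0 ∕ LEVEL-1 IDENTITY** (same hypotheses; any base bracket `ΔB`): leaf-03's ledger line at level `l+1`,
`(Xc (l+2) − Xc (l+1)) + γ·(face sums) + ΔB = 0`, holds iff `γ·((Xf 0 (l+1) − Xf 0 l) + c 1·(V 1 (l+2) − V 1 (l+1))) + ΔB = 0`. -/
theorem valLedger_iff_lowLevel
    (hcell : ∀ i, Xc (i + 1) = κ (i + 1) * V (i + 1) 1)
    (hface : ∀ k m, Xf (k + 1) m = c (k + 1) * (V (k + 1) (m + 2) - ρ * V (k + 2) (m + 1)))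
    (hc : ∀ k, c (k + 2) = ρ * c (k + 1)) (hκ : ∀ i, κ (i + 1) = γ * c (i + 1)) (l : ℕ) (ΔB : ℝ) :
    (Xc (l + 2) - Xc (l + 1)) + γ * (∑ k ∈ range (l + 2), Xf k (l + 1 - k) - ∑ k ∈ range (l + 1), Xf k (l - k)) + ΔB = 0 ↔
      γ * ((Xf 0 (l + 1) - Xf 0 l) + c 1 * (V 1 (l + 2) - V 1 (l + 1))) + ΔB = 0 := by
  rw [valLedger_lhs_eq hcell hface hc hκ l]


/-! ## §4 If the level-`0` forcing's face values have the bridge shape too, (VAL-l) is a level-`0` identity -/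

/-- NOT IN PRINT; OUR BOOKKEEPING.  **ALL THE WAY DOWN** (hypotheses of §3, plus the bridge shape AT LEVEL `0`: `Xf 0 m = c 0·(R m − ρ·V 1 (m+1))` with a level-`0` remainder
`R : ℕ → ℝ` (the Wilson-level part of the level-`0` forcing's face read — CSYM-D3-ANATOMY §3's flux technology; letter K7-0, NOT typed) and the prefactor identity extended to
level `0`, `c 1 = ρ·c 0`): the LEVEL-`1` pairings cancel as well, and leaf-03's ledger line at level `l+1` reads
`γ·c 0·(R (l+1) − R l) + ΔB = 0` — an identity between the level-`0` remainders' first difference in the period index and the OWNER's base bracket, nothing else. -/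
theorem valLedger_iff_levelZero
    (hcell : ∀ i, Xc (i + 1) = κ (i + 1) * V (i + 1) 1)
    (hface : ∀ k m, Xf (k + 1) m = c (k + 1) * (V (k + 1) (m + 2) - ρ * V (k + 2) (m + 1)))
    (hc : ∀ k, c (k + 2) = ρ * c (k + 1)) (hκ : ∀ i, κ (i + 1) = γ * c (i + 1))
    {R : ℕ → ℝ} (hface0 : ∀ m, Xf 0 m = c 0 * (R m - ρ * V 1 (m + 1))) (hc0 : c 1 = ρ * c 0) (l : ℕ) (ΔB : ℝ) :
    (Xc (l + 2) - Xc (l + 1)) + γ * (∑ k ∈ range (l + 2), Xf k (l + 1 - k) - ∑ k ∈ range (l + 1), Xf k (l - k)) + ΔB = 0 ↔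
      γ * c 0 * (R (l + 1) - R l) + ΔB = 0 := by
  rw [valLedger_lhs_eq hcell hface hc hκ l, hface0 (l + 1), hface0 l, hc0, show l + 1 + 1 = l + 2 by ring]
  constructor <;> intro h <;> linear_combination h

end Summit.QuantumFields.BalabanUV.Beta.GAN24.CrossedLedgerTelescope
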